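import Mathlib
import Literature.NumberTheory.Irrationality.RhinViola2001.GroupStructure
import HarnessLib

/-!
# Rhin–Viola 2001, §2 p. 272: the `ϑ`-invariance of the triple integrals `I(h,j,k,l,m,q,r,s)` — PROVED

Topic `Literature/NumberTheory/Irrationality/RhinViola2001`. Literature-side DISCHARGE (cell `pub-zeta5`, seat ct-1 g29,
2026-08-27) of the named fact `invariance_theta` of `GroupStructure.lean`: G. Rhin, C. Viola, *The group structure for ζ(3)*,
Acta Arith. **97** (2001) 269–293 [RhinViola2001], §2, p. 272 (held text `paper:doi-10-4064-aa97-3-6`, pp. 271–272 read on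
the page by this seat): "We employ the birational transformation `ϑ : (x,y,z) ↦ (X,Y,Z)` defined by the equations
`X = (1−y)z`, `Y = (1−x)(1−z)/(1−(1−xy)z)`, `Z = y/(1−(1−y)z)`. It is easy to check that `ϑ` has period 8, (2.4) `ϑ` maps the
open unit cube `(0,1)³` onto itself, and that under the action of `ϑ` we have
`X(1−X)Y(1−Y)Z(1−Z)/(1−(1−XY)Z) = x(1−x)y(1−y)z(1−z)/(1−(1−xy)z)` and (2.5) `dX dY dZ/(1−(1−XY)Z) = −dx dy dz/(1−(1−xy)z)`.
… if we make in (2.1) the change of variables (2.6) `ϑ⁻¹ : x = (1−Y)(1−Z)/(1−(1−XY)Z), y = (1−X)Z, z = X/(1−(1−X)Z)` and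
then replace `X, Y, Z` with `x, y, z` respectively, by virtue of (2.2), (2.3), (2.4) and (2.5) we obtain the integral
`I(j,k,l,m,q,r,s,h)`."

HONEST FRAMING (cell pub-zeta5): systematic search; no irrationality claim unless certified. An identity between triple
integrals of rational functions (a change of variables); nothing here concerns the arithmetic of `ζ(3)` or `ζ(5)`.

## What is proved, and how
* `invariance_theta_holds : invariance_theta` — for non-negative balanced parameters `I(ϑP) = I(P)`, `ϑ = (h j k l m q r s)`;
  in fact `ThetaInvariance.I_theta : P.Balanced → I (theta P) = I P` for EVERY balanced `P : Params` (non-negativity is not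
  needed: both sides are Bochner integrals over the open cube and the change-of-variables formula
  `MeasureTheory.integral_image_eq_integral_abs_det_fderiv_smul` for the injective differentiable map `ϑ⁻¹` of the
  measurable set `(0,1)³` onto itself holds unconditionally, integrable or not).
* Ingredients (namespace `ThetaInvariance`, the pattern of the tree's `CubicalSubstitutionProofs`): `ϑ⁻¹` (2.6) maps the open
  cube into itself and `ϑ` (the display before (2.4)) is its two-sided inverse there (`theta_thetaInv`, `thetaInv_theta`,
  `thetaInv_image`, `thetaInv_injOn`); `ϑ⁻¹` is differentiable on the cube with Jacobian determinant
  `−(1−X)(1−Z)/(1−(1−XY)Z)²` (`hasFDerivAt_thetaInv`; this is (2.5): `1−(1−xy)z = (1−X)(1−Z)/(1−(1−XY)Z)` at `ϑ⁻¹(X,Y,Z)`);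
  and the POINTWISE identity `|det| · integrand P (ϑ⁻¹ p) = integrand (ϑP) p` on the cube (`integrand_thetaInv`), an identity of
  Laurent monomials in the eight positive atoms `X, 1−X, Y, 1−Y, Z, 1−Z, 1−(1−XY)Z, 1−(1−X)Z` which holds exactly under
  (2.2) `h+m = k+r` and (2.3) `j+q = l+s`, proved by comparing logarithms.
The maps are written inline (no new definition). Theorems only; no new named fact (net debt −1).
-/

noncomputable section

namespace Literature.NumberTheory.Irrationality.RhinViola2001

open MeasureTheory Set
open ContinuousLinearMap (proj)

namespace ThetaInvariance

/-! ### The open cube and elementary inequalities -/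

/-- The open cube `(0,1)³` of `GroupStructure.lean` is the product of three open unit intervals.
[cite: RhinViola2001, §2 (2.4)] -/
theorem cube_eq_pi : cube = Set.pi Set.univ (fun _ : Fin 3 => Ioo (0 : ℝ) 1) := by
  ext p; simp [cube, Set.mem_pi]

/-- The open cube is measurable. [cite: RhinViola2001, §2 (2.4)] -/
theorem measurableSet_cube : MeasurableSet cube := by
  rw [cube_eq_pi]
  exact MeasurableSet.univ_pi fun _ => measurableSet_Ioo

/-- For `0 < u < 1` and `0 < v < 1`: `0 < 1 − (1−u)v`, `u/(1 − (1−u)v) < 1`, and `0 < (1−u)v < 1`.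
[cite: RhinViola2001, §2 (2.4)] -/
theorem aux_W {u v : ℝ} (hu : 0 < u) (hu' : u < 1) (hv : 0 < v) (hv' : v < 1) :
    0 < 1 - (1 - u) * v ∧ u / (1 - (1 - u) * v) < 1 ∧ 0 < (1 - u) * v ∧ (1 - u) * v < 1 := by
  have h1 : 0 < (1 - u) * v := mul_pos (by linarith) hv
  have h2 : (1 - u) * v < 1 - u := by nlinarith
  have hW : 0 < 1 - (1 - u) * v := by linarith
  refine ⟨hW, ?_, h1, by linarith⟩
  rw [div_lt_one hW]
  nlinarith

/-- For `0 < u, v, w < 1`: `0 < 1 − (1−uv)w` and `0 < (1−v)(1−w)/(1 − (1−uv)w) < 1` (positivity of the last factor of (2.1)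
on the cube; the first coordinate of `ϑ⁻¹`, resp. the second of `ϑ`, lies in `(0,1)`). [cite: RhinViola2001, §2 (2.4)] -/
theorem aux_D {u v w : ℝ} (hu : 0 < u) (hu' : u < 1) (hv : 0 < v) (hv' : v < 1) (hw : 0 < w) (hw' : w < 1) :
    0 < 1 - (1 - u * v) * w ∧ 0 < (1 - v) * (1 - w) / (1 - (1 - u * v) * w)
      ∧ (1 - v) * (1 - w) / (1 - (1 - u * v) * w) < 1 := by
  have huv : 0 < u * v := mul_pos hu hv
  have huv' : u * v < 1 := by nlinarith
  have h1 : (1 - u * v) * w < 1 - u * v := by nlinarith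
  have hD : 0 < 1 - (1 - u * v) * w := by linarith
  refine ⟨hD, div_pos (mul_pos (by linarith) (by linarith)) hD, ?_⟩
  rw [div_lt_one hD]
  have : 0 < u * v * w := mul_pos huv hw
  nlinarith

/-- `1 − a/d = (d − a)/d`. [cite: RhinViola2001, §2 (2.6)] -/
theorem one_sub_div' {a d : ℝ} (hd : d ≠ 0) : 1 - a / d = (d - a) / d := by
  field_simp

/-! ### The factors of (2.1) at `ϑ⁻¹(X,Y,Z)` as monomials in the atoms (substitution (2.6)) -/

/-- At `ϑ⁻¹(X,Y,Z)`: `1 − x = Y(1−(1−X)Z)/(1−(1−XY)Z)`. [cite: RhinViola2001, §2 (2.6)] -/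
theorem inv_one_sub_x {X Y Z : ℝ} (hD : 1 - (1 - X * Y) * Z ≠ 0) :
    1 - (1 - Y) * (1 - Z) / (1 - (1 - X * Y) * Z) = Y * (1 - (1 - X) * Z) / (1 - (1 - X * Y) * Z) := by
  rw [one_sub_div' hD]; congr 1; ring

/-- At `ϑ⁻¹(X,Y,Z)`: `1 − z = (1−X)(1−Z)/(1−(1−X)Z)`. [cite: RhinViola2001, §2 (2.6)] -/
theorem inv_one_sub_z {X Z : ℝ} (hW : 1 - (1 - X) * Z ≠ 0) :
    1 - X / (1 - (1 - X) * Z) = (1 - X) * (1 - Z) / (1 - (1 - X) * Z) := by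
  rw [one_sub_div' hW]; congr 1; ring

/-- At `ϑ⁻¹(X,Y,Z)`: `1 − (1−xy)z = (1−X)(1−Z)/(1−(1−XY)Z)` — the identity behind (2.5). [cite: RhinViola2001, §2 (2.5)–(2.6)] -/
theorem inv_D {X Y Z : ℝ} (hD : 1 - (1 - X * Y) * Z ≠ 0) (hW : 1 - (1 - X) * Z ≠ 0) :
    1 - (1 - (1 - Y) * (1 - Z) / (1 - (1 - X * Y) * Z) * ((1 - X) * Z)) * (X / (1 - (1 - X) * Z))
      = (1 - X) * (1 - Z) / (1 - (1 - X * Y) * Z) := by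
  rw [div_mul_eq_mul_div, one_sub_div' hD, div_mul_div_comm, one_sub_div' (mul_ne_zero hD hW),
    div_eq_div_iff (mul_ne_zero hD hW) hD]
  ring

/-- `ϑ ∘ ϑ⁻¹ = id`, first coordinate: at `ϑ⁻¹(X,Y,Z)`, `(1−y)z = X`. [cite: RhinViola2001, §2 (2.4), (2.6)] -/
theorem inv_c0 {X Z : ℝ} (hW : 1 - (1 - X) * Z ≠ 0) : (1 - (1 - X) * Z) * (X / (1 - (1 - X) * Z)) = X := by
  rw [mul_div_assoc', mul_div_cancel_left₀ _ hW]

/-- `ϑ ∘ ϑ⁻¹ = id`, second coordinate: at `ϑ⁻¹(X,Y,Z)`, `(1−x)(1−z)/(1−(1−xy)z) = Y`. [cite: RhinViola2001, §2 (2.4), (2.6)] -/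
theorem inv_c1 {X Y Z : ℝ} (hD : 1 - (1 - X * Y) * Z ≠ 0) (hW : 1 - (1 - X) * Z ≠ 0) (hX : 1 - X ≠ 0)
    (hZ : 1 - Z ≠ 0) :
    (1 - (1 - Y) * (1 - Z) / (1 - (1 - X * Y) * Z)) * (1 - X / (1 - (1 - X) * Z)) /
        (1 - (1 - (1 - Y) * (1 - Z) / (1 - (1 - X * Y) * Z) * ((1 - X) * Z)) * (X / (1 - (1 - X) * Z))) = Y := by
  rw [inv_one_sub_x hD, inv_one_sub_z hW, inv_D hD hW, div_eq_iff (div_ne_zero (mul_ne_zero hX hZ) hD),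
    div_mul_div_comm, mul_div_assoc', div_eq_div_iff (mul_ne_zero hD hW) hD]
  ring

/-- `ϑ ∘ ϑ⁻¹ = id`, third coordinate: at `ϑ⁻¹(X,Y,Z)`, `y/(1−(1−y)z) = Z`. [cite: RhinViola2001, §2 (2.4), (2.6)] -/
theorem inv_c2 {X Z : ℝ} (hW : 1 - (1 - X) * Z ≠ 0) (hX : 1 - X ≠ 0) :
    (1 - X) * Z / (1 - (1 - (1 - X) * Z) * (X / (1 - (1 - X) * Z))) = Z := by
  rw [inv_c0 hW, mul_comm, mul_div_assoc, div_self hX, mul_one]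

/-! ### The same for `ϑ` (the display before (2.4)): `ϑ⁻¹ ∘ ϑ = id` -/

/-- At `ϑ(x,y,z)`: `1 − Y = x(1−(1−y)z)/(1−(1−xy)z)`. [cite: RhinViola2001, §2 (2.4)] -/
theorem fwd_one_sub_Y {x y z : ℝ} (hΔ : 1 - (1 - x * y) * z ≠ 0) :
    1 - (1 - x) * (1 - z) / (1 - (1 - x * y) * z) = x * (1 - (1 - y) * z) / (1 - (1 - x * y) * z) := by
  rw [one_sub_div' hΔ]; congr 1; ring

/-- At `ϑ(x,y,z)`: `1 − Z = (1−y)(1−z)/(1−(1−y)z)`. [cite: RhinViola2001, §2 (2.4)] -/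
theorem fwd_one_sub_Z {y z : ℝ} (hω : 1 - (1 - y) * z ≠ 0) :
    1 - y / (1 - (1 - y) * z) = (1 - y) * (1 - z) / (1 - (1 - y) * z) := by
  rw [one_sub_div' hω]; congr 1; ring

/-- At `ϑ(x,y,z)`: `1 − (1−XY)Z = (1−y)(1−z)/(1−(1−xy)z)`. [cite: RhinViola2001, §2 (2.4)–(2.5)] -/
theorem fwd_D {x y z : ℝ} (hΔ : 1 - (1 - x * y) * z ≠ 0) (hω : 1 - (1 - y) * z ≠ 0) :
    1 - (1 - (1 - y) * z * ((1 - x) * (1 - z) / (1 - (1 - x * y) * z))) * (y / (1 - (1 - y) * z))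
      = (1 - y) * (1 - z) / (1 - (1 - x * y) * z) := by
  rw [mul_div_assoc' ((1 - y) * z), one_sub_div' hΔ, div_mul_div_comm, one_sub_div' (mul_ne_zero hΔ hω),
    div_eq_div_iff (mul_ne_zero hΔ hω) hΔ]
  ring

/-- `ϑ⁻¹ ∘ ϑ = id`, first coordinate. [cite: RhinViola2001, §2 (2.4), (2.6)] -/
theorem fwd_c0 {x y z : ℝ} (hΔ : 1 - (1 - x * y) * z ≠ 0) (hω : 1 - (1 - y) * z ≠ 0) (hy : 1 - y ≠ 0)
    (hz : 1 - z ≠ 0) :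
    (1 - (1 - x) * (1 - z) / (1 - (1 - x * y) * z)) * (1 - y / (1 - (1 - y) * z)) /
        (1 - (1 - (1 - y) * z * ((1 - x) * (1 - z) / (1 - (1 - x * y) * z))) * (y / (1 - (1 - y) * z))) = x := by
  rw [fwd_one_sub_Y hΔ, fwd_one_sub_Z hω, fwd_D hΔ hω, div_eq_iff (div_ne_zero (mul_ne_zero hy hz) hΔ),
    div_mul_div_comm, mul_div_assoc', div_eq_div_iff (mul_ne_zero hΔ hω) hΔ]
  ring

/-- `ϑ⁻¹ ∘ ϑ = id`, second coordinate. [cite: RhinViola2001, §2 (2.4), (2.6)] -/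
theorem fwd_c1 {y z : ℝ} (hω : 1 - (1 - y) * z ≠ 0) : (1 - (1 - y) * z) * (y / (1 - (1 - y) * z)) = y := by
  rw [mul_div_assoc', mul_div_cancel_left₀ _ hω]

/-- `ϑ⁻¹ ∘ ϑ = id`, third coordinate. [cite: RhinViola2001, §2 (2.4), (2.6)] -/
theorem fwd_c2 {y z : ℝ} (hω : 1 - (1 - y) * z ≠ 0) (hy : 1 - y ≠ 0) :
    (1 - y) * z / (1 - (1 - (1 - y) * z) * (y / (1 - (1 - y) * z))) = z := by
  rw [fwd_c1 hω, mul_comm, mul_div_assoc, div_self hy, mul_one]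

/-! ### `ϑ⁻¹` (2.6) maps the cube onto itself, injectively -/

/-- `ϑ⁻¹` (2.6), `(X,Y,Z) ↦ ((1−Y)(1−Z)/(1−(1−XY)Z), (1−X)Z, X/(1−(1−X)Z))`, maps the open cube into itself.
[cite: RhinViola2001, §2 (2.4), (2.6)] -/
theorem thetaInv_mem_cube {p : Fin 3 → ℝ} (hp : p ∈ cube) :
    ![(1 - p 1) * (1 - p 2) / (1 - (1 - p 0 * p 1) * p 2), (1 - p 0) * p 2, p 0 / (1 - (1 - p 0) * p 2)] ∈ cube := by
  have h0 := hp 0; have h1 := hp 1; have h2 := hp 2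
  obtain ⟨-, a2, a3⟩ := aux_D h0.1 h0.2 h1.1 h1.2 h2.1 h2.2
  obtain ⟨b1, b2, b3, b4⟩ := aux_W h0.1 h0.2 h2.1 h2.2
  intro i
  fin_cases i
  · exact ⟨a2, a3⟩
  · exact ⟨b3, b4⟩
  · exact ⟨div_pos h0.1 b1, b2⟩

/-- `ϑ` (display before (2.4)), `(x,y,z) ↦ ((1−y)z, (1−x)(1−z)/(1−(1−xy)z), y/(1−(1−y)z))`, maps the open cube into itself.
[cite: RhinViola2001, §2 (2.4)] -/
theorem theta_mem_cube {p : Fin 3 → ℝ} (hp : p ∈ cube) :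
    ![(1 - p 1) * p 2, (1 - p 0) * (1 - p 2) / (1 - (1 - p 0 * p 1) * p 2), p 1 / (1 - (1 - p 1) * p 2)] ∈ cube := by
  have h0 := hp 0; have h1 := hp 1; have h2 := hp 2
  obtain ⟨b1, b2, b3, b4⟩ := aux_W h1.1 h1.2 h2.1 h2.2
  obtain ⟨-, a2, a3⟩ := aux_D h1.1 h1.2 h0.1 h0.2 h2.1 h2.2
  rw [mul_comm (p 1) (p 0)] at a2 a3
  intro i
  fin_cases i
  · exact ⟨b3, b4⟩
  · exact ⟨a2, a3⟩
  · exact ⟨div_pos h1.1 b1, b2⟩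

/-- **(2.4): `ϑ⁻¹` maps the open cube ONTO itself** (`ϑ` supplies the preimages). [cite: RhinViola2001, §2 (2.4), (2.6)] -/
theorem thetaInv_image :
    (fun p : Fin 3 → ℝ => ![(1 - p 1) * (1 - p 2) / (1 - (1 - p 0 * p 1) * p 2), (1 - p 0) * p 2, p 0 / (1 - (1 - p 0) * p 2)])
      '' cube = cube := by
  refine Subset.antisymm ?_ ?_
  · rintro _ ⟨p, hp, rfl⟩; exact thetaInv_mem_cube hp
  · intro p hp
    have h0 := hp 0; have h1 := hp 1; have h2 := hp 2
    have hΔ : 1 - (1 - p 0 * p 1) * p 2 ≠ 0 := (aux_D h0.1 h0.2 h1.1 h1.2 h2.1 h2.2).1.ne'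
    have hω : 1 - (1 - p 1) * p 2 ≠ 0 := (aux_W h1.1 h1.2 h2.1 h2.2).1.ne'
    have hy : 1 - p 1 ≠ 0 := by linarith [h1.2]
    have hz : 1 - p 2 ≠ 0 := by linarith [h2.2]
    refine ⟨_, theta_mem_cube hp, ?_⟩
    ext i
    fin_cases i
    · simp only [Matrix.cons_val_zero, Matrix.cons_val_one, Matrix.cons_val]
      exact fwd_c0 hΔ hω hy hz
    · simp only [Matrix.cons_val_zero, Matrix.cons_val_one, Matrix.cons_val]
      exact fwd_c1 hω
    · simp only [Matrix.cons_val_zero, Matrix.cons_val_one, Matrix.cons_val]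
      exact fwd_c2 hω hy

/-- `ϑ⁻¹` is injective on the open cube (each coordinate is recovered by `ϑ`). [cite: RhinViola2001, §2 (2.4), (2.6)] -/
theorem thetaInv_injOn :
    InjOn (fun p : Fin 3 → ℝ => ![(1 - p 1) * (1 - p 2) / (1 - (1 - p 0 * p 1) * p 2), (1 - p 0) * p 2,
      p 0 / (1 - (1 - p 0) * p 2)]) cube := by
  intro p hp p' hp' h
  have h0 := hp 0; have h1 := hp 1; have h2 := hp 2
  have h0' := hp' 0; have h1' := hp' 1; have h2' := hp' 2
  have hD : 1 - (1 - p 0 * p 1) * p 2 ≠ 0 := (aux_D h0.1 h0.2 h1.1 h1.2 h2.1 h2.2).1.ne'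
  have hW : 1 - (1 - p 0) * p 2 ≠ 0 := (aux_W h0.1 h0.2 h2.1 h2.2).1.ne'
  have hD' : 1 - (1 - p' 0 * p' 1) * p' 2 ≠ 0 := (aux_D h0'.1 h0'.2 h1'.1 h1'.2 h2'.1 h2'.2).1.ne'
  have hW' : 1 - (1 - p' 0) * p' 2 ≠ 0 := (aux_W h0'.1 h0'.2 h2'.1 h2'.2).1.ne'
  have hX : 1 - p 0 ≠ 0 := by linarith [h0.2]
  have hZ : 1 - p 2 ≠ 0 := by linarith [h2.2]
  have hX' : 1 - p' 0 ≠ 0 := by linarith [h0'.2]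
  have hZ' : 1 - p' 2 ≠ 0 := by linarith [h2'.2]
  -- the three coordinates of `ϑ⁻¹ p = ϑ⁻¹ p'`
  have e0 := congrFun h 0
  have e1 := congrFun h 1
  have e2 := congrFun h 2
  simp only [Matrix.cons_val_zero, Matrix.cons_val_one, Matrix.cons_val] at e0 e1 e2
  -- recover `X`, `Y`, `Z` by applying `ϑ`
  have k0 : p 0 = p' 0 := by
    have a := inv_c0 (X := p 0) (Z := p 2) hW
    rw [e2, e1] at a
    exact a.symm.trans (inv_c0 hW')
  have k1 : p 1 = p' 1 := by
    have a := inv_c1 hD hW hX hZ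
    rw [e2, e0, e1] at a
    exact a.symm.trans (inv_c1 hD' hW' hX' hZ')
  have k2 : p 2 = p' 2 := by
    have a := inv_c2 (X := p 0) (Z := p 2) hW hX
    rw [e2, e1] at a
    exact a.symm.trans (inv_c2 hW' hX')
  ext i
  fin_cases i
  · exact k0
  · exact k1
  · exact k2

/-! ### The derivative of `ϑ⁻¹` and its determinant (2.5) -/

/-- Derivative of the first coordinate `p ↦ (1−Y)(1−Z)/(1−(1−XY)Z)` of `ϑ⁻¹` away from the pole: the row
`(−(1−Y)(1−Z)YZ, −(1−Z)(1−(1−X)Z), −(1−Y)XY)/(1−(1−XY)Z)²`. [cite: RhinViola2001, §2 (2.5)] -/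
theorem hasFDerivAt_coord0 (p : Fin 3 → ℝ) (h : 1 - (1 - p 0 * p 1) * p 2 ≠ 0) :
    HasFDerivAt (fun p : Fin 3 → ℝ => (1 - p 1) * (1 - p 2) / (1 - (1 - p 0 * p 1) * p 2))
      ((-((1 - p 1) * (1 - p 2) * (p 1 * p 2)) / (1 - (1 - p 0 * p 1) * p 2) ^ 2) • (proj 0 : (Fin 3 → ℝ) →L[ℝ] ℝ)
        + (-((1 - p 2) * (1 - (1 - p 0) * p 2)) / (1 - (1 - p 0 * p 1) * p 2) ^ 2) • (proj 1 : (Fin 3 → ℝ) →L[ℝ] ℝ)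
        + (-((1 - p 1) * (p 0 * p 1)) / (1 - (1 - p 0 * p 1) * p 2) ^ 2) • (proj 2 : (Fin 3 → ℝ) →L[ℝ] ℝ)) p := by
  have hN : HasFDerivAt (fun p : Fin 3 → ℝ => (1 - p 1) * (1 - p 2))
      ((1 - p 1) • (-(proj 2 : (Fin 3 → ℝ) →L[ℝ] ℝ)) + (1 - p 2) • (-(proj 1 : (Fin 3 → ℝ) →L[ℝ] ℝ))) p :=
    ((hasFDerivAt_apply (𝕜 := ℝ) 1 p).const_sub 1).mul ((hasFDerivAt_apply (𝕜 := ℝ) 2 p).const_sub 1)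
  have hD : HasFDerivAt (fun p : Fin 3 → ℝ => 1 - (1 - p 0 * p 1) * p 2)
      (-((1 - p 0 * p 1) • (proj 2 : (Fin 3 → ℝ) →L[ℝ] ℝ)
        + p 2 • (-(p 0 • (proj 1 : (Fin 3 → ℝ) →L[ℝ] ℝ) + p 1 • (proj 0 : (Fin 3 → ℝ) →L[ℝ] ℝ))))) p :=
    ((((hasFDerivAt_apply (𝕜 := ℝ) 0 p).mul (hasFDerivAt_apply (𝕜 := ℝ) 1 p)).const_sub 1).mul
      (hasFDerivAt_apply (𝕜 := ℝ) 2 p)).const_sub 1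
  have hmul := hN.mul ((hasFDerivAt_inv h).comp p hD)
  refine HasFDerivAt.congr_fderiv (hmul.congr_of_eventuallyEq ?_) ?_
  · exact Filter.Eventually.of_forall fun q => by simp [div_eq_mul_inv]
  · ext v
    simp
    field_simp
    ring

/-- Derivative of the second coordinate `p ↦ (1−X)Z` of `ϑ⁻¹`: the row `(−Z, 0, 1−X)`. [cite: RhinViola2001, §2 (2.5)] -/
theorem hasFDerivAt_coord1 (p : Fin 3 → ℝ) :
    HasFDerivAt (fun p : Fin 3 → ℝ => (1 - p 0) * p 2)
      ((-(p 2)) • (proj 0 : (Fin 3 → ℝ) →L[ℝ] ℝ) + (1 - p 0) • (proj 2 : (Fin 3 → ℝ) →L[ℝ] ℝ)) p := by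
  have h := ((hasFDerivAt_apply (𝕜 := ℝ) 0 p).const_sub 1).mul (hasFDerivAt_apply (𝕜 := ℝ) 2 p)
  refine HasFDerivAt.congr_fderiv h ?_
  ext v
  simp
  ring

/-- Derivative of the third coordinate `p ↦ X/(1−(1−X)Z)` of `ϑ⁻¹` away from the pole: the row
`((1−Z), 0, X(1−X))/(1−(1−X)Z)²`. [cite: RhinViola2001, §2 (2.5)] -/
theorem hasFDerivAt_coord2 (p : Fin 3 → ℝ) (h : 1 - (1 - p 0) * p 2 ≠ 0) :
    HasFDerivAt (fun p : Fin 3 → ℝ => p 0 / (1 - (1 - p 0) * p 2))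
      (((1 - p 2) / (1 - (1 - p 0) * p 2) ^ 2) • (proj 0 : (Fin 3 → ℝ) →L[ℝ] ℝ)
        + ((p 0 * (1 - p 0)) / (1 - (1 - p 0) * p 2) ^ 2) • (proj 2 : (Fin 3 → ℝ) →L[ℝ] ℝ)) p := by
  have hD : HasFDerivAt (fun p : Fin 3 → ℝ => 1 - (1 - p 0) * p 2)
      (-((1 - p 0) • (proj 2 : (Fin 3 → ℝ) →L[ℝ] ℝ) + p 2 • (-(proj 0 : (Fin 3 → ℝ) →L[ℝ] ℝ)))) p :=
    (((hasFDerivAt_apply (𝕜 := ℝ) 0 p).const_sub 1).mul (hasFDerivAt_apply (𝕜 := ℝ) 2 p)).const_sub 1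
  have hmul := (hasFDerivAt_apply (𝕜 := ℝ) 0 p).mul ((hasFDerivAt_inv h).comp p hD)
  refine HasFDerivAt.congr_fderiv (hmul.congr_of_eventuallyEq ?_) ?_
  · exact Filter.Eventually.of_forall fun q => by simp [div_eq_mul_inv]
  · ext v
    simp
    field_simp
    ring

/-- The `3 × 3` determinant with the zero pattern of `D(ϑ⁻¹)` (expansion along the middle column).
[cite: RhinViola2001, §2 (2.5)] -/
theorem det_pattern (a b c d f g i : ℝ) :
    Matrix.det !![a, b, c; d, 0, f; g, 0, i] = -b * (d * i - f * g) := by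
  rw [Matrix.det_fin_three]
  simp
  ring

/-- **(2.5): `ϑ⁻¹` is differentiable away from the poles, with Jacobian determinant
`det D(ϑ⁻¹)(X,Y,Z) = −(1−X)(1−Z)/(1−(1−XY)Z)²`** ("`dX dY dZ/(1−(1−XY)Z) = −dx dy dz/(1−(1−xy)z)`", as
`1−(1−xy)z = (1−X)(1−Z)/(1−(1−XY)Z)` at `(x,y,z) = ϑ⁻¹(X,Y,Z)`, `inv_D`). The derivative is the continuous linear map whose
rows are those of `hasFDerivAt_coord0/1/2`; its matrix is computed entrywise, its determinant by `det_pattern`.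
[cite: RhinViola2001, §2 (2.5)] -/
theorem hasFDerivAt_thetaInv (p : Fin 3 → ℝ) (hD : 1 - (1 - p 0 * p 1) * p 2 ≠ 0) (hW : 1 - (1 - p 0) * p 2 ≠ 0) :
    ∃ f' : (Fin 3 → ℝ) →L[ℝ] (Fin 3 → ℝ),
      HasFDerivAt (fun p : Fin 3 → ℝ => ![(1 - p 1) * (1 - p 2) / (1 - (1 - p 0 * p 1) * p 2), (1 - p 0) * p 2,
        p 0 / (1 - (1 - p 0) * p 2)]) f' p ∧
      f'.det = -((1 - p 0) * (1 - p 2)) / (1 - (1 - p 0 * p 1) * p 2) ^ 2 := by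
  refine ⟨ContinuousLinearMap.pi
    ![(-((1 - p 1) * (1 - p 2) * (p 1 * p 2)) / (1 - (1 - p 0 * p 1) * p 2) ^ 2) • (proj 0 : (Fin 3 → ℝ) →L[ℝ] ℝ)
        + (-((1 - p 2) * (1 - (1 - p 0) * p 2)) / (1 - (1 - p 0 * p 1) * p 2) ^ 2) • (proj 1 : (Fin 3 → ℝ) →L[ℝ] ℝ)
        + (-((1 - p 1) * (p 0 * p 1)) / (1 - (1 - p 0 * p 1) * p 2) ^ 2) • (proj 2 : (Fin 3 → ℝ) →L[ℝ] ℝ),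
      (-(p 2)) • (proj 0 : (Fin 3 → ℝ) →L[ℝ] ℝ) + (1 - p 0) • (proj 2 : (Fin 3 → ℝ) →L[ℝ] ℝ),
      ((1 - p 2) / (1 - (1 - p 0) * p 2) ^ 2) • (proj 0 : (Fin 3 → ℝ) →L[ℝ] ℝ)
        + ((p 0 * (1 - p 0)) / (1 - (1 - p 0) * p 2) ^ 2) • (proj 2 : (Fin 3 → ℝ) →L[ℝ] ℝ)], ?_, ?_⟩
  · refine hasFDerivAt_pi'' fun k => ?_
    rw [ContinuousLinearMap.proj_pi]
    fin_cases k
    · simpa using hasFDerivAt_coord0 p hD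
    · simpa using hasFDerivAt_coord1 p
    · simpa using hasFDerivAt_coord2 p hW
  · have hM : LinearMap.toMatrix' ((ContinuousLinearMap.pi
      ![(-((1 - p 1) * (1 - p 2) * (p 1 * p 2)) / (1 - (1 - p 0 * p 1) * p 2) ^ 2) • (proj 0 : (Fin 3 → ℝ) →L[ℝ] ℝ)
          + (-((1 - p 2) * (1 - (1 - p 0) * p 2)) / (1 - (1 - p 0 * p 1) * p 2) ^ 2) • (proj 1 : (Fin 3 → ℝ) →L[ℝ] ℝ)
          + (-((1 - p 1) * (p 0 * p 1)) / (1 - (1 - p 0 * p 1) * p 2) ^ 2) • (proj 2 : (Fin 3 → ℝ) →L[ℝ] ℝ),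
        (-(p 2)) • (proj 0 : (Fin 3 → ℝ) →L[ℝ] ℝ) + (1 - p 0) • (proj 2 : (Fin 3 → ℝ) →L[ℝ] ℝ),
        ((1 - p 2) / (1 - (1 - p 0) * p 2) ^ 2) • (proj 0 : (Fin 3 → ℝ) →L[ℝ] ℝ)
          + ((p 0 * (1 - p 0)) / (1 - (1 - p 0) * p 2) ^ 2) • (proj 2 : (Fin 3 → ℝ) →L[ℝ] ℝ)] :
          (Fin 3 → ℝ) →L[ℝ] (Fin 3 → ℝ)) : (Fin 3 → ℝ) →ₗ[ℝ] (Fin 3 → ℝ))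
        = !![-((1 - p 1) * (1 - p 2) * (p 1 * p 2)) / (1 - (1 - p 0 * p 1) * p 2) ^ 2,
              -((1 - p 2) * (1 - (1 - p 0) * p 2)) / (1 - (1 - p 0 * p 1) * p 2) ^ 2,
              -((1 - p 1) * (p 0 * p 1)) / (1 - (1 - p 0 * p 1) * p 2) ^ 2;
             -(p 2), 0, 1 - p 0;
             (1 - p 2) / (1 - (1 - p 0) * p 2) ^ 2, 0, (p 0 * (1 - p 0)) / (1 - (1 - p 0) * p 2) ^ 2] := by
      ext i j
      rw [LinearMap.toMatrix'_apply]
      fin_cases i <;> fin_cases j <;> simp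
    rw [ContinuousLinearMap.det, ← LinearMap.det_toMatrix', hM, det_pattern]
    have hW2 : (1 - (1 - p 0) * p 2) ^ 2 ≠ 0 := pow_ne_zero 2 hW
    have hD2 : (1 - (1 - p 0 * p 1) * p 2) ^ 2 ≠ 0 := pow_ne_zero 2 hD
    -- the `2 × 2` minor: `−(1−X)/(1−(1−X)Z)`
    have hb : -(p 2) * (p 0 * (1 - p 0) / (1 - (1 - p 0) * p 2) ^ 2) - (1 - p 0) * ((1 - p 2) / (1 - (1 - p 0) * p 2) ^ 2)
        = -(1 - p 0) / (1 - (1 - p 0) * p 2) := by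
      rw [mul_div_assoc', mul_div_assoc', ← sub_div, div_eq_div_iff hW2 hW]
      ring
    rw [hb, neg_div, neg_neg, div_mul_div_comm, div_eq_div_iff (mul_ne_zero hD2 hW) hD2]
    ring

/-! ### The pointwise identity of the integrands -/

/-- **Pointwise identity** (the content of the substitution (2.6)): for `0 < X, Y, Z < 1` and BALANCED parameters
((2.2) `h+m = k+r`, (2.3) `j+q = l+s`),
`(1−X)(1−Z)/(1−(1−XY)Z)² · integrand P (ϑ⁻¹(X,Y,Z)) = integrand (ϑP) (X,Y,Z)`.
Proof: at `ϑ⁻¹(X,Y,Z)` every factor of (2.1) is a Laurent monomial in the positive atoms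
`X, 1−X, Y, 1−Y, Z, 1−Z, 1−(1−XY)Z, 1−(1−X)Z` (`inv_one_sub_x`, `inv_one_sub_z`, `inv_D`); compare logarithms — the two
balance conditions are exactly what is needed (they fix the exponents of `1−X`, of `1−(1−X)Z` and of `1−(1−XY)Z`).
[cite: RhinViola2001, §2 p. 272 ((2.2)–(2.6))] -/
theorem integrand_thetaInv_coord (P : Params) (hB : P.Balanced) (X Y Z : ℝ)
    (hX : 0 < X) (hX' : X < 1) (hY : 0 < Y) (hY' : Y < 1) (hZ : 0 < Z) (hZ' : Z < 1) :
    (1 - X) * (1 - Z) / (1 - (1 - X * Y) * Z) ^ 2 *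
        integrand P ![(1 - Y) * (1 - Z) / (1 - (1 - X * Y) * Z), (1 - X) * Z, X / (1 - (1 - X) * Z)]
      = integrand (theta P) ![X, Y, Z] := by
  obtain ⟨hB1, hB2⟩ := hB
  -- positivity of the atoms
  have uX : 0 < 1 - X := by linarith
  have uY : 0 < 1 - Y := by linarith
  have uZ : 0 < 1 - Z := by linarith
  have hD : 0 < 1 - (1 - X * Y) * Z := (aux_D hX hX' hY hY' hZ hZ').1
  have hW : 0 < 1 - (1 - X) * Z := (aux_W hX hX' hZ hZ').1
  simp only [integrand, theta, Matrix.cons_val_zero, Matrix.cons_val_one, Matrix.cons_val]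
  rw [inv_one_sub_x hD.ne', inv_one_sub_z hW.ne', inv_D hD.ne' hW.ne']
  -- eliminate `m` and `s` by the balance conditions
  rw [show P.m = P.k + P.r - P.h by omega, show P.s = P.j + P.q - P.l by omega]
  -- generalize the atoms
  set D := 1 - (1 - X * Y) * Z with hDdef
  set W := 1 - (1 - X) * Z with hWdef
  set vX := 1 - X with hvX
  set vY := 1 - Y with hvY
  set vZ := 1 - Z with hvZ
  clear_value D W vX vY vZ
  -- both sides are positive: compare logarithms
  refine (Real.log_injOn_pos.eq_iff ?_ ?_).1 ?_
  · rw [Set.mem_Ioi]; positivity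
  · rw [Set.mem_Ioi]; positivity
  simp (disch := positivity) only [Real.log_mul, Real.log_div, Real.log_zpow, Real.log_pow]
  push_cast
  ring

/-- The pointwise identity on the open cube, in the form used by the change of variables.
[cite: RhinViola2001, §2 p. 272 ((2.2)–(2.6))] -/
theorem integrand_thetaInv (P : Params) (hB : P.Balanced) {p : Fin 3 → ℝ} (hp : p ∈ cube) :
    (1 - p 0) * (1 - p 2) / (1 - (1 - p 0 * p 1) * p 2) ^ 2 *
        integrand P ![(1 - p 1) * (1 - p 2) / (1 - (1 - p 0 * p 1) * p 2), (1 - p 0) * p 2, p 0 / (1 - (1 - p 0) * p 2)]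
      = integrand (theta P) p := by
  have h0 := hp 0; have h1 := hp 1; have h2 := hp 2
  have hp' : p = ![p 0, p 1, p 2] := by ext i; fin_cases i <;> simp
  conv_rhs => rw [hp']
  exact integrand_thetaInv_coord P hB (p 0) (p 1) (p 2) h0.1 h0.2 h1.1 h1.2 h2.1 h2.2

/-! ### The change of variables -/

/-- **`ϑ`-invariance for every balanced parameter vector:** `I(ϑP) = I(P)` for ALL `P : Params` with (2.2)–(2.3)
(no sign hypothesis: the change-of-variables formula for the injective differentiable map `ϑ⁻¹` on the measurable set
`(0,1)³`, whose image is `(0,1)³`, holds for the Bochner integral unconditionally). [cite: RhinViola2001, §2 p. 272] -/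
theorem I_theta (P : Params) (hB : P.Balanced) : I (theta P) = I P := by
  -- a derivative at every point (junk `0` off the cube, where nothing is claimed)
  have hex : ∀ p : Fin 3 → ℝ, ∃ f' : (Fin 3 → ℝ) →L[ℝ] (Fin 3 → ℝ), p ∈ cube →
      HasFDerivAt (fun p : Fin 3 → ℝ => ![(1 - p 1) * (1 - p 2) / (1 - (1 - p 0 * p 1) * p 2), (1 - p 0) * p 2,
        p 0 / (1 - (1 - p 0) * p 2)]) f' p ∧
      f'.det = -((1 - p 0) * (1 - p 2)) / (1 - (1 - p 0 * p 1) * p 2) ^ 2 := by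
    intro p
    by_cases hp : p ∈ cube
    · obtain ⟨f', hf'⟩ := hasFDerivAt_thetaInv p
        (aux_D (hp 0).1 (hp 0).2 (hp 1).1 (hp 1).2 (hp 2).1 (hp 2).2).1.ne'
        (aux_W (hp 0).1 (hp 0).2 (hp 2).1 (hp 2).2).1.ne'
      exact ⟨f', fun _ => hf'⟩
    · exact ⟨0, fun h => (hp h).elim⟩
  choose f' hf' using hex
  have hderiv : ∀ p ∈ cube, HasFDerivWithinAt (fun p : Fin 3 → ℝ => ![(1 - p 1) * (1 - p 2) / (1 - (1 - p 0 * p 1) * p 2),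
      (1 - p 0) * p 2, p 0 / (1 - (1 - p 0) * p 2)]) (f' p) cube p := fun p hp =>
    (hf' p hp).1.hasFDerivWithinAt
  have hcv := integral_image_eq_integral_abs_det_fderiv_smul volume measurableSet_cube hderiv thetaInv_injOn
    (integrand P)
  rw [thetaInv_image] at hcv
  unfold I
  rw [hcv]
  refine (setIntegral_congr_fun measurableSet_cube fun p hp => ?_).symm
  have h0 := hp 0; have h1 := hp 1; have h2 := hp 2
  have hD := (aux_D h0.1 h0.2 h1.1 h1.2 h2.1 h2.2).1
  have hpos : 0 < (1 - p 0) * (1 - p 2) / (1 - (1 - p 0 * p 1) * p 2) ^ 2 :=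
    div_pos (mul_pos (by linarith [h0.2]) (by linarith [h2.2])) (pow_pos hD 2)
  rw [(hf' p hp).2, neg_div, abs_neg, abs_of_pos hpos, smul_eq_mul]
  exact integrand_thetaInv P hB hp

end ThetaInvariance

/-- **Rhin–Viola's `ϑ`-invariance holds** (the named fact `invariance_theta` of `GroupStructure.lean` is a theorem): for
non-negative integers `h, j, k, l, m, q, r, s` with `h+m = k+r`, `j+q = l+s`, `I(h,j,k,l,m,q,r,s) = I(j,k,l,m,q,r,s,h)` — "if we
make in (2.1) the change of variables `ϑ⁻¹` … we obtain the integral `I(j,k,l,m,q,r,s,h)`. Hence with the action of `ϑ` on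
`I(h,j,k,l,m,q,r,s)` we associate the cyclic permutation `ϑ = (h j k l m q r s)`" (so, with the file's proved `invariance_sigma`,
"the value of `I(h,j,k,l,m,q,r,s)` is invariant under the action of the group `Θ = ⟨ϑ, σ⟩`"). From `ThetaInvariance.I_theta`,
which does not even need non-negativity. [cite: RhinViola2001, §2 p. 272 ((2.4)–(2.6))] -/
theorem invariance_theta_holds : invariance_theta := fun P _ hB => ThetaInvariance.I_theta P hB

end Literature.NumberTheory.Irrationality.RhinViola2001

end
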